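import Summits.ABC.IUTFork.Joshi.InitialThetaDataJoshi
import Literature.IUT.HodgeTheaters.InitialThetaDataPlaces
import HarnessLib

/-!
# [J-III] Lemma 3.2.1 (1): the «if» half PROVED for Joshi's typed data

Proof-only companion (theorems only) of `Joshi/InitialThetaDataJoshi.lean` (abc-iut-E-t6, p428841), rung LADDER-ABC:A2.E.
TAKES NO SIDE on [IUTchIII] Cor. 3.12 or on any author; typed ≠ proved. K. Joshi, arXiv:2401.13508v4 Lemma 3.2.1 (1), p.27
l.31–34: «`w ∈ V^good_{L_mod}` if and only if `w | 2` or `X` has good reduction at `w` or has bad additive reduction at `w`»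
(«immediate from the definitions»), typed as the claim `ATS3.Lemma321 C` with «`X` has … reduction at `w`» read at every
place of `L` over `w` (READING flag of the statement file). Here the «IF» direction is PROVED: since every prime `w` of
`L_mod` has a place `v` of `L` above it (the tree's `Val.restrict_surjective`), good (resp. additive) reduction at every
place over `w` excludes multiplicative reduction at that `v` (local trichotomy, the tree's `LocalReduction` API), so `w` is not
in `V^{odd,ss}_{L_mod}`; and `w | 2` is `mem_vgoodMod_of_residueChar_two`. The «only if» half is not a formal consequence under
the ∀-reading (mixed reduction types above one `w` are not excluded by §3.1) — recorded in the statement file, not claimed here.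
[claim: Joshi2024ATS3, status: disputed]
-/

noncomputable section

open scoped Classical
open NumberField IsDedekindDomain
open Literature.IUT.HodgeTheaters hiding InitialThetaData

universe u

namespace Summit.ABC.IUTFork.Joshi.ATS3

variable {L : Type u} [Field L] [NumberField L] (C : WeierstrassCurve L) [C.IsElliptic]

/-- Every prime `w` of `L_mod = ℚ(j_C)` lies under some finite place `v` of `L` (restriction of places is surjective and
sends finite places to finite places). PROVED. [folklore] -/
theorem exists_liesOverMod (w : FinitePlace (fieldOfModuli C)) : ∃ v : FinitePlace L, LiesOverMod C v w := by
  obtain ⟨u, hu⟩ := Val.restrict_surjective (fieldOfModuli C) (M := L) (Val.non w)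
  rcases u with u | v
  · exact absurd hu (by simp [Val.restrict, Val.non])
  · exact ⟨v, hu⟩

/-- **[J-III] Lemma 3.2.1 (1), «if» half** (p.27 l.31–34): if `w | 2`, or `X` has good reduction at (every place of `L` over)
`w`, or additive reduction at (every place over) `w`, then `w ∈ V^good_{L_mod}`. PROVED. [claim: Joshi2024ATS3, status: disputed] -/
theorem lemma321_if (w : FinitePlace (fieldOfModuli C))
    (h : residueChar w = 2 ∨ (∀ v : FinitePlace L, LiesOverMod C v w → C.HasGoodReductionAt v.maximalIdeal) ∨
      (∀ v : FinitePlace L, LiesOverMod C v w → C.HasAdditiveReductionAt v.maximalIdeal)) :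
    w ∈ VgoodMod C := by
  rcases h with h2 | hg | ha
  · exact mem_vgoodMod_of_residueChar_two C w h2
  · obtain ⟨v, hv⟩ := exists_liesOverMod C w
    exact mem_vgoodMod_of_exists C w v hv (Or.inl (hg v hv))
  · obtain ⟨v, hv⟩ := exists_liesOverMod C w
    exact mem_vgoodMod_of_exists C w v hv (Or.inr (ha v hv))

/-- The typed claim `Lemma321 C` therefore reduces to its «only if» half. PROVED. [claim: Joshi2024ATS3, status: disputed] -/
theorem lemma321_iff_onlyIf : Lemma321 C ↔ ∀ w : FinitePlace (fieldOfModuli C), w ∈ VgoodMod C →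
    residueChar w = 2 ∨ (∀ v : FinitePlace L, LiesOverMod C v w → C.HasGoodReductionAt v.maximalIdeal) ∨
      (∀ v : FinitePlace L, LiesOverMod C v w → C.HasAdditiveReductionAt v.maximalIdeal) :=
  ⟨fun h w hw => (h w).mp hw, fun h w => ⟨h w, lemma321_if C w⟩⟩

end Summit.ABC.IUTFork.Joshi.ATS3

end
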